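import Literature.NumberTheory.Automorphic.StableCentralizerEquivCM               -- ★ `archStableCentralizerEquiv`, `coe_archStableCentralizerEquiv_eq_of_conj_eq`, `isUnit_map_of_det_ne_zero`
import Literature.NumberTheory.Automorphic.UnitaryGroupArchimedeanPlaces            -- ★ `archLocal`, `archPiEquivCM`, `evalC`
import Literature.NumberTheory.Automorphic.OrbitalMeasureQuotientOfPoint             -- ★ `continuous_mulAutConj`, `subgroupCongrHomeomorph`, (W)(C)-at-a-point lemmas
import Literature.MeasureTheory.Group.InvariantQuotientTransport                    -- ★ `subgroupCongrHomeomorph`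
import Literature.MeasureTheory.Group.InvariantQuotientPiNormalized                 -- ★ `subgroupPiCoords`
import HarnessLib

/-!
# R90-TF ∕ S2 «Ch. 12 archimedean block» — `R90S2ArchLocalTorusTransport`: the LOCAL stable-centraliser isomorphisms `Z(δ₁) ≃ₜ* Z(δ₂)` on `U(σ_w H)(ℂ)` and
# their compatibility with ★ `archStableCentralizerEquiv` along ★ `archPiEquivCM` (orbital-product road FILE 3a, the algebra of print's measure transport)

Cell `pub/hodgecm-mathlib`, HCML Track R90-TF, section S2 (base `R90-C11`), crux h413 = `stmt-HodgeConjecture-24833`, route of record `HCCMUnconditional`; prover seat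
LH4-p05 (g11) (S2 desk K2E1b-plan (g8) deal 2026-09-05T02:23:15Z (4) «FILE 3»); lane `--supports stmt-HodgeConjecture-24833 --as helper` (`--kind definition`: two
`ContinuousMulEquiv`s are DEFINED).  Conventions of ★ `R90S2ArchOrbitalProductOfWeilForm`: no socket, no instance, no notation, no `sorry`, default heartbeats.

## WHY
T2's archimedean measure convention is (W) «`m_∞ [γ] = dν ∕ dt_γ`» + (C) «`t` is transported along ★ `archStableCentralizerEquiv` under stable conjugacy»
(★ `TransferFactsCanonical` :645–:660).  To turn it into the PRODUCT clause of ★ CARD 3 `isArchStablyNull_of_place` (FILE 3b `R90S2ArchProductFamilyOfQuotient`)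
one needs the LOCAL twin of the transport at every complex place `w` and the fact that the global transport IS the product of the local ones in the coordinates
`e = archPiEquivCM`.  Everything here is algebra∕topology (no measure is moved yet):
* `isRegularElt_archPiEquivCM` — the components `γ_w = (e γ)_w ∈ U(σ_w H)(ℂ)` of a regular `γ ∈ G_∞` are regular (`charpoly (γ_w) = σ_w (charpoly γ)` is separable).
* `archLocalStableCentralizerEquiv hH hc h₁ : Z(δ₁) ≃ₜ* Z(δ₂)` for `δ₁ ∼st δ₂` in `U(σ_w H)(ℂ)` (conjugate in `GL_N(ℂ)`, ★ LETTER #4 §5 currency), `δ₁` regular: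
  ★ `Corresponds.centralizerContinuousEquiv` with the commutative-commutant hypothesis discharged by separability over `ℂ`; `coe_…_eq_of_conj_eq` — it is
  conjugation by ANY `GL_N(ℂ)`-conjugator (conjugator independence); `subgroupCongrHomeomorph_conj_comp_…` — composing with an inner conjugation of
  `U(σ_w H)(ℂ)` gives the transport to the conjugate (the cocycle law the local torus measures of FILE 3b inherit).
* `archCentralizerPiEquiv H γ : Z(γ) ≃ₜ* ∏_w Z(γ_w)` — the centraliser of `γ` in `G_∞` IS the product of the local centralisers along `e`
  (`coe_archCentralizerPiEquiv_apply` rfl; `= subgroupPiCoords ∘ subgroupCongrHomeomorph e` definitionally, the two spellings of ★ `InvariantQuotientTransport` ∕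
  ★ `InvariantQuotientPiNormalized`).
* `archCentralizerPiEquiv_archStableCentralizerEquiv` — **THE GLOBAL TRANSPORT IS THE PRODUCT OF THE LOCAL ONES**: for `γ ↔ γ'` regular,
  `archCentralizerPiEquiv γ' ∘ archStableCentralizerEquiv = (∏_w archLocalStableCentralizerEquiv_w) ∘ archCentralizerPiEquiv γ` (both sides are conjugation by
  an ambient conjugator `y ∈ GL_N(L ⊗ ℝ)` resp. by its components `GL_N(ev_w) y`).

HONEST LABEL: algebraic plumbing for the measure convention; pays no printed input; HC_CM is proved only modulo the 7 printed citations (2 remaining named inputs: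
hLiu418 = `stmt-HodgeConjecture-24832`, h413 = `stmt-HodgeConjecture-24833`) until rung 0 closes.  Count-neutral.

References: [Rogawski1990] §1.7 p. 6, §3.1 p. 19, §4.3 pp. 43–44; [LanglandsShelstad1987] §1.3–1.4; [Shelstad1979] §4 p. 20; [BorelJacquet1979] §4.1.
-/

set_option autoImplicit false
set_option linter.dupNamespace false  -- the route namespace `Summit.HodgeConjecture.HodgeConjecture.…` repeats a component by design (as ★ FILE 1)

noncomputable section

open MeasureTheory NumberField NumberField.InfinitePlace
open scoped Matrix MatrixGroups Classical
open Literature.NumberTheory.Automorphic Literature.NumberTheory.Automorphic.UnitaryGroup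
open Literature.NumberTheory.Rogawski1990
open Literature.LinearAlgebra.Matrix
open Literature.MeasureTheory.Group

namespace Summit.HodgeConjecture.HodgeConjecture.R90.S2

/-! ## §1 Regular components and the local commutant -/

section Local

variable {L : Type} [Field L] [NumberField L] [IsCMField L] {N : ℕ} (H : Matrix (Fin N) (Fin N) L)

/-- The underlying invertible matrix of the component `(e γ)_w` is `GL_N(ev_w) γ` (definitional read-back of ★ `archPiEquivCM`). [folklore] -/
theorem coe_archPiEquivCM_eq_map_evalC (γ : ↥(arch (↥(maximalRealSubfield L)) L (IsCMField.complexConj L) N H)) (w : {w : InfinitePlace L // w.IsComplex}) :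
    ((archPiEquivCM L H (N := N) γ w : ↥(archLocal L N H w)) : GL (Fin N) ℂ) =
      Matrix.GeneralLinearGroup.map (evalC L w) (γ : GL (Fin N) (mixedEmbedding.mixedSpace L)) :=
  rfl

/-- **The components of a regular element are regular**: `charpoly ((e γ)_w) = ev_w (charpoly γ)` is separable. [cite: Rogawski1990, §3.1 p. 19] -/
theorem isRegularElt_archPiEquivCM (γ : ↥(arch (↥(maximalRealSubfield L)) L (IsCMField.complexConj L) N H))
    (hγ : IsRegularElt (γ.val : GL (Fin N) (mixedEmbedding.mixedSpace L))) (w : {w : InfinitePlace L // w.IsComplex}) :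
    IsRegularElt ((archPiEquivCM L H (N := N) γ w : ↥(archLocal L N H w)) : GL (Fin N) ℂ) := by
  rw [isRegularElt_iff, coe_archPiEquivCM_eq_map_evalC]
  change (((γ : GL (Fin N) (mixedEmbedding.mixedSpace L)) : Matrix (Fin N) (Fin N) (mixedEmbedding.mixedSpace L)).map
    (evalC L w)).charpoly.Separable
  rw [Matrix.charpoly_map]
  exact hγ.map

omit [NumberField L] [IsCMField L] in
/-- The `GL_N(ℂ)`-commutant of a regular `δ ∈ U(σ_w H)(ℂ)` is commutative (separable characteristic polynomial over the field `ℂ`).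
[cite: Rogawski1990, §3.1 p. 19] -/
theorem commute_of_commute_of_isRegularElt_archLocal {w : {w : InfinitePlace L // w.IsComplex}} (δ : ↥(archLocal L N H w))
    (hδ : IsRegularElt (δ : GL (Fin N) ℂ)) :
    ∀ B C : Matrix (Fin N) (Fin N) ℂ, Commute B ((δ : GL (Fin N) ℂ) : Matrix (Fin N) (Fin N) ℂ) →
      Commute C ((δ : GL (Fin N) ℂ) : Matrix (Fin N) (Fin N) ℂ) → Commute B C :=
  fun _ _ hB hC => commute_of_commute_of_charpoly_separable hδ hB hC

/-! ## §2 The local stable-centraliser isomorphism `Z(δ₁) ≃ₜ* Z(δ₂)` on `U(σ_w H)(ℂ)` -/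

/-- **LOCAL `Z(δ₁) ≃ₜ* Z(δ₂)` for stably conjugate `δ₁, δ₂ ∈ U(σ_w H)(ℂ)`** (`δ₁ ∼st δ₂`: conjugate in the ambient `GL_N(ℂ)`; `δ₁` regular; `det H ≠ 0`):
★ `Corresponds.centralizerContinuousEquiv` — conjugation by a `GL_N(ℂ)`-conjugator, well defined into `U(σ_w H)(ℂ)` and independent of the conjugator because
the commutant of the regular `δ₁` is commutative.  The local twin of ★ `archStableCentralizerEquiv`; the isomorphism `T_{δ₁} ≅ T_{δ₂}` of the real tori
along which print's compatible measures are transported. [cite: Rogawski1990, §4.3 pp. 43–44] [cite: LanglandsShelstad1987, §1.3] -/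
def archLocalStableCentralizerEquiv (hH : H.det ≠ 0) {w : {w : InfinitePlace L // w.IsComplex}} {δ₁ δ₂ : ↥(archLocal L N H w)}
    (hc : IsStablyConj (starRingEnd ℂ) (H.map w.1.embedding) δ₁ δ₂) (h₁ : IsRegularElt (δ₁ : GL (Fin N) ℂ)) :
    Subgroup.centralizer ({δ₁} : Set ↥(archLocal L N H w)) ≃ₜ* Subgroup.centralizer ({δ₂} : Set ↥(archLocal L N H w)) :=
  (corresponds_self_iff.mpr hc).centralizerContinuousEquiv (isUnit_map_of_det_ne_zero L _ hH) (isUnit_map_of_det_ne_zero L _ hH)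
    (commute_of_commute_of_isRegularElt_archLocal H δ₁ h₁)
    (commute_of_commute_of_isRegularElt_archLocal H δ₂ (isRegularElt_of_isConj hc h₁))

omit [NumberField L] [IsCMField L] in
/-- **Conjugator independence**: the matrix of `archLocalStableCentralizerEquiv z` is `y z y⁻¹` for EVERY `y ∈ GL_N(ℂ)` with `y δ₁ y⁻¹ = δ₂`.
[cite: Rogawski1990, §4.3 pp. 43–44] [cite: Shelstad1979, §4 p. 20] -/
theorem coe_archLocalStableCentralizerEquiv_eq_of_conj_eq (hH : H.det ≠ 0) {w : {w : InfinitePlace L // w.IsComplex}}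
    {δ₁ δ₂ : ↥(archLocal L N H w)} (hc : IsStablyConj (starRingEnd ℂ) (H.map w.1.embedding) δ₁ δ₂) (h₁ : IsRegularElt (δ₁ : GL (Fin N) ℂ))
    (y : GL (Fin N) ℂ) (hy : y * (δ₁ : GL (Fin N) ℂ) * y⁻¹ = δ₂) (z : Subgroup.centralizer ({δ₁} : Set ↥(archLocal L N H w))) :
    (((archLocalStableCentralizerEquiv H hH hc h₁ z : Subgroup.centralizer ({δ₂} : Set ↥(archLocal L N H w))) : ↥(archLocal L N H w)) :
        GL (Fin N) ℂ) = y * ((z : ↥(archLocal L N H w)) : GL (Fin N) ℂ) * y⁻¹ :=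
  conj_eq_conj_of_conj_eq (commute_of_commute_of_isRegularElt_archLocal H δ₁ h₁) (corresponds_self_iff.mpr hc).conjugator_spec hy
    (congrArg Subtype.val (Subgroup.mem_centralizer_singleton_iff.mp z.2))

omit [NumberField L] [IsCMField L] in
/-- Conjugate elements of `U(σ_w H)(ℂ)` are stably conjugate. [cite: Rogawski1990, §3.1 p. 19] -/
theorem isStablyConj_archLocal_of_mulAutConj_eq {w : {w : InfinitePlace L // w.IsComplex}} {δ₁ δ₂ : ↥(archLocal L N H w)}
    (q : ↥(archLocal L N H w)) (hq : (MulAut.conj q : _ ≃* ↥(archLocal L N H w)) δ₁ = δ₂) :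
    IsStablyConj (starRingEnd ℂ) (H.map w.1.embedding) δ₁ δ₂ :=
  isConj_iff.mpr ⟨(q : GL (Fin N) ℂ), congrArg Subtype.val hq⟩

omit [NumberField L] [IsCMField L] in
/-- Stable conjugacy in `U(σ_w H)(ℂ)` is transitive (it is `IsConj` in `GL_N(ℂ)`). [cite: Rogawski1990, §3.1 p. 19] -/
theorem isStablyConj_trans_archLocal {w : {w : InfinitePlace L // w.IsComplex}} {δ₁ δ₂ δ₃ : ↥(archLocal L N H w)}
    (h₁₂ : IsStablyConj (starRingEnd ℂ) (H.map w.1.embedding) δ₁ δ₂) (h₂₃ : IsStablyConj (starRingEnd ℂ) (H.map w.1.embedding) δ₂ δ₃) :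
    IsStablyConj (starRingEnd ℂ) (H.map w.1.embedding) δ₁ δ₃ :=
  IsConj.trans h₁₂ h₂₃

omit [NumberField L] [IsCMField L] in
/-- **The cocycle law with inner conjugations**: for `δ₁ ∼st δ₂` and `q ∈ U(σ_w H)(ℂ)`, the conjugation homeomorphism `Z(δ₂) ≃ₜ Z(q δ₂ q⁻¹)` composed with
the transport `Z(δ₁) ≃ₜ* Z(δ₂)` IS the transport `Z(δ₁) ≃ₜ* Z(q δ₂ q⁻¹)` (as functions) — both are conjugation by `q y` for a conjugator `y` of `δ₁ ↦ δ₂`.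
[cite: Shelstad1979, §4 p. 20] [cite: Rogawski1990, §4.3 pp. 43–44] -/
theorem subgroupCongrHomeomorph_conj_comp_archLocalStableCentralizerEquiv (hH : H.det ≠ 0) {w : {w : InfinitePlace L // w.IsComplex}}
    {δ₁ δ₂ δ₃ : ↥(archLocal L N H w)} (hc : IsStablyConj (starRingEnd ℂ) (H.map w.1.embedding) δ₁ δ₂) (h₁ : IsRegularElt (δ₁ : GL (Fin N) ℂ))
    (q : ↥(archLocal L N H w)) (hq : (MulAut.conj q : _ ≃* ↥(archLocal L N H w)) δ₂ = δ₃) :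
    (subgroupCongrHomeomorph (MulAut.conj q : _ ≃* ↥(archLocal L N H w)) (Subgroup.centralizer ({δ₂} : Set _))
        (Subgroup.centralizer ({δ₃} : Set _)) (forall_apply_mem_centralizer_singleton_iff_of_eq (MulAut.conj q : _ ≃* _) hq)
        (continuous_mulAutConj q) (continuous_mulAutConj_symm q)) ∘
        (archLocalStableCentralizerEquiv H hH hc h₁) =
      archLocalStableCentralizerEquiv H hH (isStablyConj_trans_archLocal H hc (isStablyConj_archLocal_of_mulAutConj_eq H q hq)) h₁ := by
  funext z
  apply Subtype.ext
  apply Subtype.ext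
  have hy : (q : GL (Fin N) ℂ) * (corresponds_self_iff.mpr hc).conjugator * (δ₁ : GL (Fin N) ℂ) *
      ((q : GL (Fin N) ℂ) * (corresponds_self_iff.mpr hc).conjugator)⁻¹ = δ₃ := by
    rw [mul_inv_rev, show (q : GL (Fin N) ℂ) * (corresponds_self_iff.mpr hc).conjugator * (δ₁ : GL (Fin N) ℂ) *
        ((corresponds_self_iff.mpr hc).conjugator⁻¹ * (q : GL (Fin N) ℂ)⁻¹) =
      (q : GL (Fin N) ℂ) * ((corresponds_self_iff.mpr hc).conjugator * (δ₁ : GL (Fin N) ℂ) * (corresponds_self_iff.mpr hc).conjugator⁻¹) *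
        (q : GL (Fin N) ℂ)⁻¹ by group, (corresponds_self_iff.mpr hc).conjugator_spec]
    exact congrArg Subtype.val hq
  rw [Function.comp_apply]
  change (q : GL (Fin N) ℂ) *
      (((archLocalStableCentralizerEquiv H hH hc h₁ z : Subgroup.centralizer ({δ₂} : Set _)) : ↥(archLocal L N H w)) : GL (Fin N) ℂ) *
        (q : GL (Fin N) ℂ)⁻¹ =
    (((archLocalStableCentralizerEquiv H hH (isStablyConj_trans_archLocal H hc (isStablyConj_archLocal_of_mulAutConj_eq H q hq)) h₁ z :
        Subgroup.centralizer ({δ₃} : Set _)) : ↥(archLocal L N H w)) : GL (Fin N) ℂ)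
  rw [coe_archLocalStableCentralizerEquiv_eq_of_conj_eq H hH hc h₁ _ (corresponds_self_iff.mpr hc).conjugator_spec z,
    coe_archLocalStableCentralizerEquiv_eq_of_conj_eq H hH _ h₁ _ hy z]
  group

end Local

/-! ## §3 `Z(γ) ≅ ∏_w Z(γ_w)` along `e = archPiEquivCM`, and the global transport as the product of the local ones -/

section Global

variable {L : Type} [Field L] [NumberField L] [IsCMField L] {N : ℕ} (H : Matrix (Fin N) (Fin N) L)

/-- A component of a central(ising) element centralises the component: `z ∈ Z(γ) ⇒ (e z)_w ∈ Z(γ_w)`. [folklore] -/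
theorem archPiEquivCM_mem_centralizer (γ : ↥(arch (↥(maximalRealSubfield L)) L (IsCMField.complexConj L) N H))
    (z : Subgroup.centralizer ({γ} : Set ↥(arch (↥(maximalRealSubfield L)) L (IsCMField.complexConj L) N H)))
    (w : {w : InfinitePlace L // w.IsComplex}) :
    archPiEquivCM L H (N := N) (z : ↥(arch (↥(maximalRealSubfield L)) L (IsCMField.complexConj L) N H)) w ∈
      Subgroup.centralizer ({archPiEquivCM L H (N := N) γ w} : Set ↥(archLocal L N H w)) := by
  rw [Subgroup.mem_centralizer_singleton_iff]
  have h := congrArg (fun x => archPiEquivCM L H (N := N) x w) (Subgroup.mem_centralizer_singleton_iff.mp z.2)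
  simp only [map_mul] at h
  exact h

/-- A tuple of local centralising elements glues to a centralising element: `(∀ w, p_w ∈ Z(γ_w)) ⇒ e⁻¹ p ∈ Z(γ)`. [folklore] -/
theorem archPiEquivCM_symm_mem_centralizer (γ : ↥(arch (↥(maximalRealSubfield L)) L (IsCMField.complexConj L) N H))
    (p : ∀ w : {w : InfinitePlace L // w.IsComplex}, Subgroup.centralizer ({archPiEquivCM L H (N := N) γ w} : Set ↥(archLocal L N H w))) :
    (archPiEquivCM L H (N := N)).symm (fun w => (p w : ↥(archLocal L N H w))) ∈
      Subgroup.centralizer ({γ} : Set ↥(arch (↥(maximalRealSubfield L)) L (IsCMField.complexConj L) N H)) := by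
  rw [Subgroup.mem_centralizer_singleton_iff]
  apply (archPiEquivCM L H (N := N)).injective
  rw [map_mul, map_mul, ContinuousMulEquiv.apply_symm_apply]
  funext w
  exact Subgroup.mem_centralizer_singleton_iff.mp (p w).2

/-- **`Z(γ) ≃ₜ* ∏_w Z(γ_w)`**: the centraliser of `γ` in `G_∞ = U(H)(L ⊗ ℝ)` is the product of the centralisers of its components `γ_w = (e γ)_w` in the
`U(σ_w H)(ℂ)`, along `e = archPiEquivCM` (`z ↦ ((e z)_w)_w`).  [cite: BorelJacquet1979, §4.1] [cite: Rogawski1990, §4.3 pp. 43–44] -/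
def archCentralizerPiEquiv (γ : ↥(arch (↥(maximalRealSubfield L)) L (IsCMField.complexConj L) N H)) :
    Subgroup.centralizer ({γ} : Set ↥(arch (↥(maximalRealSubfield L)) L (IsCMField.complexConj L) N H)) ≃ₜ*
      ∀ w : {w : InfinitePlace L // w.IsComplex}, Subgroup.centralizer ({archPiEquivCM L H (N := N) γ w} : Set ↥(archLocal L N H w)) where
  toFun z := fun w => ⟨archPiEquivCM L H (N := N) (z : ↥(arch (↥(maximalRealSubfield L)) L (IsCMField.complexConj L) N H)) w,
    archPiEquivCM_mem_centralizer H γ z w⟩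
  invFun p := ⟨(archPiEquivCM L H (N := N)).symm (fun w => (p w : ↥(archLocal L N H w))), archPiEquivCM_symm_mem_centralizer H γ p⟩
  left_inv z := Subtype.ext ((archPiEquivCM L H (N := N)).symm_apply_apply _)
  right_inv p := funext fun w => Subtype.ext (by
    change archPiEquivCM L H (N := N) ((archPiEquivCM L H (N := N)).symm fun w => (p w : ↥(archLocal L N H w))) w = _
    rw [ContinuousMulEquiv.apply_symm_apply])
  map_mul' z z' := funext fun w => Subtype.ext (by
    change archPiEquivCM L H (N := N) ((z : ↥(arch (↥(maximalRealSubfield L)) L (IsCMField.complexConj L) N H)) * z') w = _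
    rw [map_mul]
    rfl)
  continuous_toFun := continuous_pi fun w =>
    (((continuous_apply w).comp (archPiEquivCM L H (N := N)).continuous).comp continuous_subtype_val).subtype_mk _
  continuous_invFun :=
    ((archPiEquivCM L H (N := N)).symm.continuous.comp (continuous_pi fun w => continuous_subtype_val.comp (continuous_apply w))).subtype_mk _

/-- Read-back: `((archCentralizerPiEquiv γ z) w : U(σ_w H)(ℂ)) = (e z)_w` (definitional). [folklore] -/
theorem coe_archCentralizerPiEquiv_apply (γ : ↥(arch (↥(maximalRealSubfield L)) L (IsCMField.complexConj L) N H))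
    (z : Subgroup.centralizer ({γ} : Set ↥(arch (↥(maximalRealSubfield L)) L (IsCMField.complexConj L) N H))) (w : {w : InfinitePlace L // w.IsComplex}) :
    ((archCentralizerPiEquiv H γ z w : Subgroup.centralizer ({archPiEquivCM L H (N := N) γ w} : Set ↥(archLocal L N H w))) : ↥(archLocal L N H w)) =
      archPiEquivCM L H (N := N) (z : ↥(arch (↥(maximalRealSubfield L)) L (IsCMField.complexConj L) N H)) w :=
  rfl

/-- **The two spellings agree**: `archCentralizerPiEquiv γ = subgroupPiCoords ∘ subgroupCongrHomeomorph e` (the coordinates of ★ `InvariantQuotientPiNormalized` after the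
subgroup transport of ★ `InvariantQuotientTransport` along `e.toMulEquiv`, with the compatibility letter «`e z ∈ ∏_w Z(γ_w) ↔ z ∈ Z(γ)`») — definitional.
[folklore] -/
theorem archCentralizerPiEquiv_eq_comp (γ : ↥(arch (↥(maximalRealSubfield L)) L (IsCMField.complexConj L) N H))
    (hmem : ∀ g : ↥(arch (↥(maximalRealSubfield L)) L (IsCMField.complexConj L) N H),
      (archPiEquivCM L H (N := N)).toMulEquiv g ∈
          Subgroup.pi Set.univ (fun w : {w : InfinitePlace L // w.IsComplex} =>
            Subgroup.centralizer ({archPiEquivCM L H (N := N) γ w} : Set ↥(archLocal L N H w))) ↔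
        g ∈ Subgroup.centralizer ({γ} : Set ↥(arch (↥(maximalRealSubfield L)) L (IsCMField.complexConj L) N H))) :
    (archCentralizerPiEquiv H γ : _ → ∀ w : {w : InfinitePlace L // w.IsComplex},
        Subgroup.centralizer ({archPiEquivCM L H (N := N) γ w} : Set ↥(archLocal L N H w))) =
      subgroupPiCoords (fun w : {w : InfinitePlace L // w.IsComplex} =>
          Subgroup.centralizer ({archPiEquivCM L H (N := N) γ w} : Set ↥(archLocal L N H w))) ∘
        subgroupCongrHomeomorph (archPiEquivCM L H (N := N)).toMulEquiv
          (Subgroup.centralizer ({γ} : Set ↥(arch (↥(maximalRealSubfield L)) L (IsCMField.complexConj L) N H)))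
          (Subgroup.pi Set.univ (fun w : {w : InfinitePlace L // w.IsComplex} =>
            Subgroup.centralizer ({archPiEquivCM L H (N := N) γ w} : Set ↥(archLocal L N H w))))
          hmem (archPiEquivCM L H (N := N)).continuous (archPiEquivCM L H (N := N)).symm.continuous :=
  rfl

/-- **Stably conjugate global elements have stably conjugate components** (apply `GL_N(ev_w)` to an ambient conjugator). [cite: Rogawski1990, §3.1 p. 19; §14.2 p. 232] -/
theorem isStablyConj_archPiEquivCM {γ γ' : ↥(arch (↥(maximalRealSubfield L)) L (IsCMField.complexConj L) N H)}
    (hc : Corresponds (conjMixed (↥(maximalRealSubfield L)) L (IsCMField.complexConj L)) (archFormOf L N H) (archFormOf L N H) γ γ')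
    (w : {w : InfinitePlace L // w.IsComplex}) :
    IsStablyConj (starRingEnd ℂ) (H.map w.1.embedding) (archPiEquivCM L H (N := N) γ w) (archPiEquivCM L H (N := N) γ' w) := by
  obtain ⟨y, hy⟩ := isConj_iff.mp hc
  refine isConj_iff.mpr ⟨Matrix.GeneralLinearGroup.map (evalC L w) y, ?_⟩
  rw [coe_archPiEquivCM_eq_map_evalC, coe_archPiEquivCM_eq_map_evalC, ← map_inv, ← map_mul, ← map_mul]
  exact congrArg _ hy

/-- **THE GLOBAL TRANSPORT IS THE PRODUCT OF THE LOCAL TRANSPORTS** (pointwise, at one place): for `γ ↔ γ'` regular in `G_∞`, the `w`-component of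
`archStableCentralizerEquiv z` is `archLocalStableCentralizerEquiv_w ((e z)_w)` — both are conjugation by the `w`-component `GL_N(ev_w) y` of an ambient
conjugator `y`. [cite: Rogawski1990, §4.3 pp. 43–44] [cite: LanglandsShelstad1987, §1.3–1.4] -/
theorem archPiEquivCM_archStableCentralizerEquiv (hH : H.det ≠ 0) {γ γ' : ↥(arch (↥(maximalRealSubfield L)) L (IsCMField.complexConj L) N H)}
    (hc : Corresponds (conjMixed (↥(maximalRealSubfield L)) L (IsCMField.complexConj L)) (archFormOf L N H) (archFormOf L N H) γ γ')
    (hγ : IsRegularElt (γ.val : GL (Fin N) (mixedEmbedding.mixedSpace L)))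
    (z : Subgroup.centralizer ({γ} : Set ↥(arch (↥(maximalRealSubfield L)) L (IsCMField.complexConj L) N H))) (w : {w : InfinitePlace L // w.IsComplex}) :
    archCentralizerPiEquiv H γ' (archStableCentralizerEquiv L hH hH hc hγ z) w =
      archLocalStableCentralizerEquiv H hH (isStablyConj_archPiEquivCM H hc w) (isRegularElt_archPiEquivCM H γ hγ w)
        (archCentralizerPiEquiv H γ z w) := by
  obtain ⟨y, hy⟩ := isConj_iff.mp hc
  have hyw : Matrix.GeneralLinearGroup.map (evalC L w) y * ((archPiEquivCM L H (N := N) γ w : ↥(archLocal L N H w)) : GL (Fin N) ℂ) *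
      (Matrix.GeneralLinearGroup.map (evalC L w) y)⁻¹ = ((archPiEquivCM L H (N := N) γ' w : ↥(archLocal L N H w)) : GL (Fin N) ℂ) := by
    rw [coe_archPiEquivCM_eq_map_evalC, coe_archPiEquivCM_eq_map_evalC, ← map_inv, ← map_mul, ← map_mul]
    exact congrArg _ hy
  apply Subtype.ext
  apply Subtype.ext
  rw [coe_archLocalStableCentralizerEquiv_eq_of_conj_eq H hH _ _ _ hyw, coe_archCentralizerPiEquiv_apply, coe_archCentralizerPiEquiv_apply,
    coe_archPiEquivCM_eq_map_evalC, coe_archPiEquivCM_eq_map_evalC]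
  change Matrix.GeneralLinearGroup.map (evalC L w)
      (((archStableCentralizerEquiv L hH hH hc hγ z : Subgroup.centralizer ({γ'} : Set _)) :
        ↥(arch (↥(maximalRealSubfield L)) L (IsCMField.complexConj L) N H)).val) = _
  rw [coe_archStableCentralizerEquiv_eq_of_conj_eq L hH hH hc hγ y hy z, map_mul, map_mul, map_inv]

/-- The same as an identity of maps `Z(γ) → ∏_w Z(γ'_w)`:
`archCentralizerPiEquiv γ' ∘ archStableCentralizerEquiv = (p ↦ (archLocalStableCentralizerEquiv_w (p w))_w) ∘ archCentralizerPiEquiv γ`.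
[cite: Rogawski1990, §4.3 pp. 43–44] [cite: LanglandsShelstad1987, §1.3–1.4] -/
theorem archCentralizerPiEquiv_comp_archStableCentralizerEquiv (hH : H.det ≠ 0)
    {γ γ' : ↥(arch (↥(maximalRealSubfield L)) L (IsCMField.complexConj L) N H)}
    (hc : Corresponds (conjMixed (↥(maximalRealSubfield L)) L (IsCMField.complexConj L)) (archFormOf L N H) (archFormOf L N H) γ γ')
    (hγ : IsRegularElt (γ.val : GL (Fin N) (mixedEmbedding.mixedSpace L))) :
    (archCentralizerPiEquiv H γ' : _ → ∀ w : {w : InfinitePlace L // w.IsComplex},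
          Subgroup.centralizer ({archPiEquivCM L H (N := N) γ' w} : Set ↥(archLocal L N H w))) ∘
        (archStableCentralizerEquiv L hH hH hc hγ) =
      (fun (p : ∀ w : {w : InfinitePlace L // w.IsComplex}, Subgroup.centralizer ({archPiEquivCM L H (N := N) γ w} : Set ↥(archLocal L N H w)))
          (w : {w : InfinitePlace L // w.IsComplex}) =>
        archLocalStableCentralizerEquiv H hH (isStablyConj_archPiEquivCM H hc w) (isRegularElt_archPiEquivCM H γ hγ w) (p w)) ∘
        (archCentralizerPiEquiv H γ) := by
  funext z
  funext w
  exact archPiEquivCM_archStableCentralizerEquiv H hH hc hγ z w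

end Global

end Summit.HodgeConjecture.HodgeConjecture.R90.S2

end
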